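import Summits.QuantumFields.YangMills.Theorems.FemtoCutoffLadderThinningDefs
import Summits.QuantumFields.YangMills.Theorems.FemtoTransferGapSlab
import Literature.MathematicalPhysics.QuantumFieldTheory.TorusConfigShift
import HarnessLib

/-!
# Route `FlatTubeReduction` (LINE g6-A «unit-slab ladder») — DEFINITIONS: the MOMENTUM-COVARIANT pinned engines
# (bear on crux `UnitUpStep` stmt-QuantumFields-27556 and the shared crux `UpStepEv` stmt-QuantumFields-26796; R2b1 RECORD rung — no summit)

Seat ym-line-fcl-p3 g11 (2026-08-28).  The registered engines of the two «ti-split» lines — `PinnedUnitStepEx` (27561, unit pair) and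
`PinnedUpStepEx` (27379, pairs `L′ < L < 2L′`) — build the fine variational trial state from the coarse first excitation `φ′` as
`ψ = f̄·Ω`, `f̄ = |Λ_L|⁻¹ Σ_v (φ′/Ω′) ∘ thin L′ ∘ τ_v` = the PLAIN (zero fine momentum) translation average of the thinning pull-back, and their
registered hard stubs (`stub_pinnedAutocorrExTI1`, `stub_pinnedAutocorrExTI`) demand a TRANSLATION-INVARIANT `secondValue′`-eigenfunction `φ′`.
That conjunct is «zero-momentum first excitation» along the femto window — a dispersion bound `E(p ≠ 0) > E₁` for the interacting lattice theory,
uniform in `L′`, for which no rigorous source exists (SIZING-27561-stub2, (P1)); and the plain average needs the smear-injectivity stub W-inj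
(landed at `m = 1` only, p642758; open for general `m`).

Both are idle for the min–max door.  This file types the momentum-covariant engines in which the coefficients of the translates are FREE:
* `spanTrial L′ a g Ω : U ↦ (Σ_{v ∈ (ℤ/L)³} a v · g(thin L′ (τ_v U))) · Ω U` — the real span of the fine translates of the pull-back of a coarse
  multiplier `g` (here `g = φ′/Ω′`), dressed by the fine ground state `Ω`; `a ≡ |Λ_L|⁻¹` is the plain average of the filed cruxes, `a = δ₀` the RAW
  pull-back, `a = cos / sin (2π k·v/L)` the momentum-`k` (twisted) averages matching a coarse excitation of momentum `k`;
* `PinnedSpanUnitStep` — unit pair `(L′, L′+1)`, budget `exp(C·Λ²/L′)`: `∃ φ′` (ANY normalised physical `secondValue′`-eigenfunction `⊥ Ω′`, no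
  translation invariance) `∃ a`, `Var(ψ_a) > 0 ∧` the one-sided `(L′+1)`-step autocorrelation comparison for `ψ_a = spanTrial L′ a (φ′/Ω′) Ω`;
* `RawPinnedUnitStep` — the same with the RAW pull-back `a = δ₀` and NO kinematic conjunct (its variance positivity is a theorem:
  `PinnedSpan.l2_rawTrial_sq_lt`, sibling file `…PinnedSpanStepKinematics`);
* `PinnedSpanUpStep` — pairs `L′ < L < 2L′`, budget `exp(C·Λ²)` (the `FemtoCutoffLadder`/`FlatTubeReduction` shared crux `UpStepEv`).
Doors (sibling file `…PinnedSpanStepDoor`): `PinnedSpanUnitStep → UnitUpStep`, `PinnedSpanUpStep → UpStepEv`, and the filed engines are STRONGER: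
`PinnedUnitStepEx → PinnedSpanUnitStep`, `PinnedUpStepEx → PinnedSpanUpStep`.  Definitions only: OPEN claims of the route (the analytic comparison is
the two-cutoff wall, XL), NOT literature facts; nothing here proves a stub, a crux, the rung or any summit.
References (mechanism, not facts): M. Lüscher, NPB 219 (1983) 233, §3; T. Balaban, CMP 98 (1985) 17, §1 (bib keys Luscher1983, Balaban1985Averaging).
-/

set_option autoImplicit false

noncomputable section

namespace Summit.QuantumFields.YangMills.Theorems.FlatTubeReduction.PinnedSpan

open MeasureTheory
open Literature.MathematicalPhysics.QuantumFieldTheory (Site GaugeConfig)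
open Literature.MathematicalPhysics.QuantumFieldTheory.TorusTranslation (torusConfigShift)
open Summit.QuantumFields.YangMills.Theorems.FemtoTransferGap
open Summit.QuantumFields.YangMills.Theorems.FemtoCutoffLadder.Thinning (thin)

/-- **The momentum-covariant pinned trial family.**  For coefficients `a : (ℤ/L)³ → ℝ`, a coarse multiplier `g` on `GaugeConfig 3 L′ SU2`
and a fine function `Ω` on `GaugeConfig 3 L SU2`:
`spanTrial L′ a g Ω (U) = (Σ_v a v · g (thin L′ (τ_v U))) · Ω U` — a real linear combination of the fine translates `τ_v = torusConfigShift v`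
of the thinning pull-back `g ∘ thin L′`, dressed by `Ω` (in the cruxes: `g = φ′/Ω′` the ground-state ratio of the coarse first excitation, `Ω` the
fine ground state; `a ≡ |Λ_L|⁻¹` recovers their plain translation average, `a = δ₀` the raw pull-back, trigonometric `a` the momentum-`k` averages).
An object posited by the route (trial-state bookkeeping), not a literature notion. -/
def spanTrial {L : ℕ} [NeZero L] (L' : ℕ) (a : Site 3 L → ℝ) (g : GaugeConfig 3 L' SU2 → ℝ) (Ω : GaugeConfig 3 L SU2 → ℝ) :
    GaugeConfig 3 L SU2 → ℝ :=
  fun U => (∑ v : Site 3 L, a v * g (thin L' (torusConfigShift v U))) * Ω U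

/-- **Momentum-covariant pinned UNIT step** (engine for crux `UnitUpStep`, stmt-QuantumFields-27556; an OPEN claim of the route, NOT a literature
fact).  Along the femto window, at the unit pair `(L′, L′+1)` with matched running parameter, for the positive normalised fine ground state `Ω`
and the coarse ground state `Ω′ ≥ c′ > 0` (both through their pointwise eigen-equations), THERE ARE a normalised physical
`secondValue′`-eigenfunction `φ′ ⊥ Ω′` (ANY momentum content — no translation invariance asked) and coefficients `a : (ℤ/(L′+1))³ → ℝ` such that
the trial `ψ = spanTrial L′ a (φ′/Ω′) Ω` has `⟨ψ,Ω⟩² < ‖ψ‖²` and obeys the one-sided `(L′+1)`-step autocorrelation comparison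
`λ₁′^{L′} λ₀^{L′+1} Var(ψ) ≤ e^{CΛ²/L′} λ₀′^{L′} (⟨ψ, K^{L′+1}ψ⟩ − λ₀^{L′+1}⟨ψ,Ω⟩²)`.  Implied by the filed engine `PinnedUnitStepEx` (27561,
`a ≡ |Λ|⁻¹`); implies `UnitUpStep` (min–max door).  (Route-posited; trial-state mechanism after Lüscher 1983 §3.) -/
def PinnedSpanUnitStep : Prop :=
  ∃ C lam0 : ℝ, 0 < lam0 ∧ ∀ lam : ℝ, 0 < lam → lam ≤ lam0 → ∃ L0 : ℕ, ∀ (L' : ℕ) [NeZero L'], L0 ≤ L' →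
    ∀ β β' : ℝ, InFemtoWindow lam β (L' + 1) → InFemtoWindow lam β' L' → luscherLambda β (L' + 1) = luscherLambda β' L' →
    ∀ Ω : GaugeConfig 3 (L' + 1) SU2 → ℝ, IsPhys Ω → (∀ U, 0 < Ω U) → l2 Ω Ω = 1 →
      (∀ U, ∫ V, transferKernel su2Rep β U V * Ω V ∂(configMeasure SU2 (L' + 1)) = topValue su2Rep (L' + 1) β * Ω U) →
    ∀ Ω' : GaugeConfig 3 L' SU2 → ℝ, IsPhys Ω' → ∀ c' : ℝ, 0 < c' → (∀ U', c' ≤ Ω' U') → l2 Ω' Ω' = 1 →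
      (∀ U', ∫ V', transferKernel su2Rep β' U' V' * Ω' V' ∂(configMeasure SU2 L') = topValue su2Rep L' β' * Ω' U') →
    ∃ φ' : GaugeConfig 3 L' SU2 → ℝ, IsPhys φ' ∧ l2 φ' Ω' = 0 ∧ l2 φ' φ' = 1 ∧
      (∀ U', ∫ V', transferKernel su2Rep β' U' V' * φ' V' ∂(configMeasure SU2 L') = secondValue su2Rep L' β' * φ' U') ∧
      ∃ a : Site 3 (L' + 1) → ℝ,
        let ψ : GaugeConfig 3 (L' + 1) SU2 → ℝ := spanTrial L' a (fun U' => φ' U' / Ω' U') Ω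
        l2 ψ Ω ^ 2 < l2 ψ ψ ∧
          secondValue su2Rep L' β' ^ L' * topValue su2Rep (L' + 1) β ^ (L' + 1) * (l2 ψ ψ - l2 ψ Ω ^ 2) ≤
            Real.exp (C * luscherLambda β (L' + 1) ^ 2 / (L' : ℝ)) *
              (topValue su2Rep L' β' ^ L' * (l2 ψ ((transferApply β)^[L' + 1] ψ) - topValue su2Rep (L' + 1) β ^ (L' + 1) * l2 ψ Ω ^ 2))

/-- **RAW pinned UNIT step** (candidate ONE-STUB skeleton of crux `UnitUpStep`, stmt-QuantumFields-27556; an OPEN claim of the route, NOT a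
literature fact): as `PinnedSpanUnitStep` with the RAW thinning pull-back `ψ₀ = ((φ′/Ω′) ∘ thin L′) · Ω` (coefficients `a = δ₀`, no smearing) and
WITHOUT the variance conjunct — for the raw pull-back `⟨ψ₀,Ω⟩² < ‖ψ₀‖²` is a THEOREM for every `φ′ ⊥ Ω′` (`PinnedSpan.l2_rawTrial_sq_lt`:
`thin L′` is measure preserving, strict Cauchy–Schwarz), so only the analytic autocorrelation comparison remains.  Leading-order leakage budget of
the raw pull-back at `m = 1` (crux workfile `Cruxes/SubOctaveBounded/ALIASING.md`, row «thin»): one-gluon weight `p₁ ≈ 2ε₁Λ·S`,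
`S = O(log L′/L′²)` for ONE doubled slab, inside `CΛ²/L′` eventually in `L′` at fixed level — the quantifier order of this statement.
Implies `PinnedSpanUnitStep`, hence `UnitUpStep`.  (Route-posited; trial-state mechanism after Lüscher 1983 §3.) -/
def RawPinnedUnitStep : Prop :=
  ∃ C lam0 : ℝ, 0 < lam0 ∧ ∀ lam : ℝ, 0 < lam → lam ≤ lam0 → ∃ L0 : ℕ, ∀ (L' : ℕ) [NeZero L'], L0 ≤ L' →
    ∀ β β' : ℝ, InFemtoWindow lam β (L' + 1) → InFemtoWindow lam β' L' → luscherLambda β (L' + 1) = luscherLambda β' L' →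
    ∀ Ω : GaugeConfig 3 (L' + 1) SU2 → ℝ, IsPhys Ω → (∀ U, 0 < Ω U) → l2 Ω Ω = 1 →
      (∀ U, ∫ V, transferKernel su2Rep β U V * Ω V ∂(configMeasure SU2 (L' + 1)) = topValue su2Rep (L' + 1) β * Ω U) →
    ∀ Ω' : GaugeConfig 3 L' SU2 → ℝ, IsPhys Ω' → ∀ c' : ℝ, 0 < c' → (∀ U', c' ≤ Ω' U') → l2 Ω' Ω' = 1 →
      (∀ U', ∫ V', transferKernel su2Rep β' U' V' * Ω' V' ∂(configMeasure SU2 L') = topValue su2Rep L' β' * Ω' U') →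
    ∃ φ' : GaugeConfig 3 L' SU2 → ℝ, IsPhys φ' ∧ l2 φ' Ω' = 0 ∧ l2 φ' φ' = 1 ∧
      (∀ U', ∫ V', transferKernel su2Rep β' U' V' * φ' V' ∂(configMeasure SU2 L') = secondValue su2Rep L' β' * φ' U') ∧
      let ψ : GaugeConfig 3 (L' + 1) SU2 → ℝ := fun U => φ' (thin L' U) / Ω' (thin L' U) * Ω U
      secondValue su2Rep L' β' ^ L' * topValue su2Rep (L' + 1) β ^ (L' + 1) * (l2 ψ ψ - l2 ψ Ω ^ 2) ≤
        Real.exp (C * luscherLambda β (L' + 1) ^ 2 / (L' : ℝ)) *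
          (topValue su2Rep L' β' ^ L' * (l2 ψ ((transferApply β)^[L' + 1] ψ) - topValue su2Rep (L' + 1) β ^ (L' + 1) * l2 ψ Ω ^ 2))

/-- **Momentum-covariant pinned UP-step for the incommensurable pairs `L′ < L < 2L′`** (engine for the shared crux `UpStepEv`,
stmt-QuantumFields-26796; an OPEN claim of the route, NOT a literature fact): the body of `PinnedUpStepEx` (27379) with the plain translation average
replaced by free coefficients `a : (ℤ/L)³ → ℝ` of the translates — `∃ φ′` (any normalised physical `secondValue′`-eigenfunction `⊥ Ω′`) `∃ a`,
`⟨ψ,Ω⟩² < ‖ψ‖² ∧ λ₁′^{L′} λ₀^{L} Var(ψ) ≤ e^{CΛ²} λ₀′^{L′} (⟨ψ, K^{L}ψ⟩ − λ₀^{L}⟨ψ,Ω⟩²)` for `ψ = spanTrial L′ a (φ′/Ω′) Ω`.  Implied by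
`PinnedUpStepEx`; implies `UpStepEv` (min–max door).  (For `m = L − L′` comparable to `L′` the raw pull-back through the front-loaded `thin` aliases an
`L`-independent one-gluon weight — ALIASING.md — so here a translation average, plain or momentum-twisted, is the intended witness.)
(Route-posited; trial-state mechanism after Lüscher 1983 §3, averaging after Balaban 1985 §1.) -/
def PinnedSpanUpStep : Prop :=
  ∃ C lam0 : ℝ, 0 < lam0 ∧ ∀ lam : ℝ, 0 < lam → lam ≤ lam0 → ∃ L0 : ℕ, ∀ (L' : ℕ) [NeZero L'] (L : ℕ) [NeZero L],
    L0 ≤ L' → L' < L → L < 2 * L' →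
    ∀ β β' : ℝ, InFemtoWindow lam β L → InFemtoWindow lam β' L' → luscherLambda β L = luscherLambda β' L' →
    ∀ Ω : GaugeConfig 3 L SU2 → ℝ, IsPhys Ω → (∀ U, 0 < Ω U) → l2 Ω Ω = 1 →
      (∀ U, ∫ V, transferKernel su2Rep β U V * Ω V ∂(configMeasure SU2 L) = topValue su2Rep L β * Ω U) →
    ∀ Ω' : GaugeConfig 3 L' SU2 → ℝ, IsPhys Ω' → ∀ c' : ℝ, 0 < c' → (∀ U', c' ≤ Ω' U') → l2 Ω' Ω' = 1 →
      (∀ U', ∫ V', transferKernel su2Rep β' U' V' * Ω' V' ∂(configMeasure SU2 L') = topValue su2Rep L' β' * Ω' U') →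
    ∃ φ' : GaugeConfig 3 L' SU2 → ℝ, IsPhys φ' ∧ l2 φ' Ω' = 0 ∧ l2 φ' φ' = 1 ∧
      (∀ U', ∫ V', transferKernel su2Rep β' U' V' * φ' V' ∂(configMeasure SU2 L') = secondValue su2Rep L' β' * φ' U') ∧
      ∃ a : Site 3 L → ℝ,
        let ψ : GaugeConfig 3 L SU2 → ℝ := spanTrial L' a (fun U' => φ' U' / Ω' U') Ω
        l2 ψ Ω ^ 2 < l2 ψ ψ ∧
          secondValue su2Rep L' β' ^ L' * topValue su2Rep L β ^ L * (l2 ψ ψ - l2 ψ Ω ^ 2) ≤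
            Real.exp (C * luscherLambda β L ^ 2) *
              (topValue su2Rep L' β' ^ L' * (l2 ψ ((transferApply β)^[L] ψ) - topValue su2Rep L β ^ L * l2 ψ Ω ^ 2))

end Summit.QuantumFields.YangMills.Theorems.FlatTubeReduction.PinnedSpan

end
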